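import Summits.QuantumFields.YangMills.Theorems.FluctuationComparisonRegPrIntLS2BetaMinimiserClosedGraph
import Summits.QuantumFields.YangMills.Theorems.FluctuationComparisonRegPrIntLS2BetaSymmetriesLiftOfCritical
import Summits.QuantumFields.YangMills.Theorems.FluctuationComparisonRegPrIntLS2BetaGapOrbitOfTubeReg
import HarnessLib

/-!
# S2β · THE MINIMAL ORBIT IS CONTINUOUS IN THE DATUM: under [Balaban1985Variational] Thm 1 sentence 2 (uniqueness of the minimal orbit), the residual-orbit
# distance to the minimal orbit is JOINTLY CONTINUOUS in `(V, U)` on window × fields — OUTRIGHT at every `L ≥ 5` (part 2 of the «continuity-of-the-minimal-orbit letter»)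

Cell `ym3-torus` (YM ladder rung R3 = continuum `SU(2)` Yang–Mills on the three-torus at fixed lattice data — a RUNG: NOT d = 4, NOT infinite volume,
NOT a mass gap, NOT Clay).  Width seat `ym3-torus-px10` (gen 20), FILE C2 (sequel of FILE C1 `…S2BetaMinimiserClosedGraph` and ✓FILE A `…S2BetaMinActionRegPrContinuousOn`);
helper of the crux `stmt-QuantumFields-20520` (`…Theses.UnitScaleTilt.FluctuationComparisonRegPrIntL`), `--supports … --as helper`, count-neutral, DEFINITION-FREE
(0 `def`, 0 `instance`, 0 `notation`, 0 `sorry`, default heartbeats).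

WHAT IS PROVED (letters of FILE A; window `W := {PlaqSmall ε₁}`).
* §3 ★★★ `continuousOn_iInf_orbitDistSq_minimiser` — for ANY selection `sel` of (8)-regular minimisers over the window (`sel V ∈ regFibrePr (B₃ε₁) V`, `A(sel V) = m V`;
  one exists by Thm 1 (8)) and under Thm 1 sentence 2 `Thm1UniqueMinOrbitAt L a₀ a₁ B₃` (a tree THEOREM at `L ≥ 5`: ✓`thm1Pair_five`), the function
  `(V, U) ↦ ⨅_{w residual} Σ_ℓ dist1 (U ℓ · (w • sel V)ℓ⁻¹)²` is `ContinuousOn (W ×ˢ univ)` — independent of the selection (all (6)(ε₀)-minimisers over `V` lie on ONE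
  residual orbit — `UniqueCriticalOrbit` + ✓`residual_of_descTransf_eq_one` —, on which the distance is constant: ✓`…S2BetaGapOrbitOfTubeReg.iInf_orbitDistSq_gaugeAct_residual`).  Proof: the generalized tube
  lemma around `{U₀} × (residual orbit of sel V₀)` inside an open sublevel tube of C1's jointly continuous distance, plus the closed-graph localisation in compact form:
  «(8)-class minimisers over data near `V₀` lie in any open neighbourhood `B` of the minimal orbit over `V₀`» — the descent image of the compact set of off-`B`
  minimisers over a closed neighbourhood of `V₀` is closed (FILE A: `m` continuous, descent continuous on the class) and misses `V₀`.
* §4 ★★ `continuousOn_iInf_orbitDistSq_minimiser_five` — every `L ≥ 5`, ZERO letters (✓`thm1Pair_five`, ✓`admissible_of_le`), with the selection supplied by Thm 1 (8).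
USE.  With FILE A §1 `lowerSemicontinuousWithinAt_of_isCompact` this is the second input of the `V`-compactness road to a window-uniform gap constant (GAP♮∘, px13 g21 (o7)):
`η(V) := inf {A(U) − m(V) : U good over V, orbit-distance(U, sel V) ≥ r}` is lower semicontinuous once its constraint set is closed — which is this file's continuity.

HONEST.  Point-set topology over landed theorems (FILE A, FILE C1, the Thm-1 pair at `L ≥ 5`); nothing of Bałaban's analysis is added; print's Prop. 9 (ANALYTIC dependence
of the minimiser on the datum) is NOT proved — this is its `C⁰`-modulo-gauge shadow; GAP♮∘ ∕ GAP♯∘ as registered, EXW∘ at `L = 3`, DET-REP-B, H4ᶜ∘, LFR♯ᶜ∘, S2β, crux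
20520, 19936, 19200 and `YM3TorusSU2` are NOT proved; no summit statement is proved by a helper; rung R3 = SU(2) YM₃ on T³ at fixed lattice data — NOT d = 4, NOT
infinite volume, NOT a mass gap, NOT Clay; the Yang–Mills mass gap is NOT proved.  Axioms standard.

References: T. Bałaban, CMP **102** (1985) 277–309 [Balaban1985Variational] ((2)–(8) p.278, Thm 1 (8)–(10) p.279, Prop. 7 p.299, Prop. 9 p.309); CMP **109** (1987)
249–301 [Balaban1987RG1] ((0.4) p.253, p.256 after (0.21)); CMP **99** (1985) 75–102 [Balaban1985RegularSpaces] ((1.9) p.77); C. Berge, *Espaces topologiques, fonctions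
multivoques* (1959) Ch. VI §3.
-/

set_option autoImplicit false

noncomputable section

namespace Summit.QuantumFields.YangMills.Theorems.FluctuationComparisonRegPrIntLS2BetaMinimalOrbitContinuousOn

open Set Filter Topology
open scoped Matrix.Norms.L2Operator
open Literature.MathematicalPhysics.QuantumFieldTheory.Balaban1983to89
open Literature.MathematicalPhysics.QuantumFieldTheory.Balaban1983to89.T3ContinuumYM3Torus
open Literature.MathematicalPhysics.QuantumFieldTheory.Balaban1983to89.T3UnitLawDensityEML (ℰp)
open Literature.MathematicalPhysics.QuantumFieldTheory.Balaban1983to89.T3PrintedRegularMinimiser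
  (RegPr DivSmall regFibrePr minActionRegPr mem_regFibrePr_iff minActionRegPr_le)
open Literature.MathematicalPhysics.QuantumFieldTheory.Balaban1983to89.T3PrintedMinimiserExistence
  (Thm1GlobalMinAt regFibrePr_mono plaqSmall_of_le regThreshold_mono minActionRegPr_eq_of_isMinOn)
open Literature.MathematicalPhysics.QuantumFieldTheory.Balaban1983to89.T3Thm1UniquenessSchema (Thm1UniqueMinOrbitAt)
open Literature.MathematicalPhysics.QuantumFieldTheory.Balaban1983to89.T3Thm1Carrier (varProblem3 SameOrbit)
open Literature.MathematicalPhysics.QuantumFieldTheory.Balaban1983to89.T3RegularMinimiser (regThreshold regFibre regThreshold_pos)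
open Literature.MathematicalPhysics.QuantumFieldTheory.Balaban1983to89.T3ConstrainedMinimiser (fibre)
open Literature.MathematicalPhysics.QuantumFieldTheory.Balaban1983to89.T3DescentFibreTower (mem_fibre_iff)
open Literature.MathematicalPhysics.QuantumFieldTheory.Balaban1983to89.T3TiltDescent (descendTo)
open Literature.MathematicalPhysics.QuantumFieldTheory.Balaban1983to89.B10Eq27TorusAxialLog (toUField unitsField)
open Literature.MathematicalPhysics.QuantumFieldTheory.Balaban1983to89.B10Eq68TorusRegularity (covDivT)
open Literature.MathematicalPhysics.QuantumFieldTheory.Balaban1983to89.ExpMeanLog (deltaSU deltaSU_pos)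
open Summit.QuantumFields.YangMills.BalabanUVNodes.N07DirectMethod (continuous_wilsonAction4 continuous_dist1_plaqHol isCompact_of_isClosed_cfg)
open Summit.QuantumFields.YangMills.Theorems.MinimiserPin (continuousAt_descendTo_of_plaqLe isClosed_plaqLe isClosed_divLe)
open Summit.QuantumFields.YangMills.Theorems.FluctuationComparisonRegPrIntLS2BetaResidualGauge
  (residual_of_descTransf_eq_one compactSpace_residualGauge)
open Summit.QuantumFields.YangMills.Theorems.FluctuationComparisonRegPrIntLS2BetaMinActionRegPrContinuousOn (continuousOn_minActionRegPr)
open Summit.QuantumFields.YangMills.Theorems.FluctuationComparisonRegPrIntLS2BetaMinimiserClosedGraph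
  (continuous_iInf_orbitDistSq₂ continuous_gaugeAct_residual)
open Summit.QuantumFields.YangMills.Theorems.FluctuationComparisonRegPrIntLS2BetaGapOrbitOfTubeReg (iInf_orbitDistSq_gaugeAct_residual)

/-! ## §3 ★★★ The residual-orbit distance to the minimal orbit is jointly continuous on window × fields -/

section MinimalOrbit

variable (F : T3Family)

/-- ★★★ **THE MINIMAL ORBIT IS CONTINUOUS IN THE DATUM** (C⁰ shadow, modulo gauge, of [Balaban1985Variational] Prop. 9): under Thm 1 (8) AND Thm 1 sentence 2
(uniqueness of the minimal orbit in (6)), for ANY selection `sel` of (8)-regular minimisers over the window, the residual-orbit distance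
`(V, U) ↦ ⨅_{w residual} Σ_ℓ dist1 (U ℓ · (w • sel V)ℓ⁻¹)²` is `ContinuousOn ({PlaqSmall ε₁} ×ˢ univ)`. [cite: Balaban1985Variational, Thm 1 (8)-(10) p.279, Prop. 7 p.299 and Prop. 9 p.309] -/
theorem continuousOn_iInf_orbitDistSq_minimiser {L : ℕ} {a₀ a₁ B₃ : ℝ} (hT : Thm1GlobalMinAt L a₀ a₁ B₃) (hU1 : Thm1UniqueMinOrbitAt L a₀ a₁ B₃)
    (hB₃ : 0 < B₃) (hF : F.L = L) {n K : ℕ} (hnK : n < K) {ε₁ ε₀ : ℝ} (hε₁ : 0 < ε₁) (hε₁a : ε₁ ≤ a₁) (hlo : B₃ * ε₁ < ε₀) (hhi : ε₀ ≤ a₀)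
    (hr3 : (143 * ((((3 + 4 : ℕ) : ℝ)) ^ 2 / 4) ^ 2) * (2 * ε₀) ≤ 1 / 3)
    (hr2 : 2 * (2 * ε₀) ≤ 2 * deltaSU (Fin 2) / (((3 + 4) * F.L : ℕ) : ℝ) ^ 2)
    (sel : GaugeField (F.P n) 0 (Matrix.specialUnitaryGroup (Fin 2) ℂ) → GaugeField (F.P K) 0 (Matrix.specialUnitaryGroup (Fin 2) ℂ))
    (hsel : ∀ V : GaugeField (F.P n) 0 (Matrix.specialUnitaryGroup (Fin 2) ℂ), PlaqSmall ε₁ V →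
      sel V ∈ regFibrePr F n K hnK.le (B₃ * ε₁) V ∧ wilsonAction4 (sel V) = minActionRegPr F n K hnK.le ε₀ V) :
    ContinuousOn (fun p : GaugeField (F.P n) 0 (Matrix.specialUnitaryGroup (Fin 2) ℂ) × GaugeField (F.P K) 0 (Matrix.specialUnitaryGroup (Fin 2) ℂ) =>
        ⨅ w : {w : Site (F.P K) 0 → Matrix.specialUnitaryGroup (Fin 2) ℂ |
            ∀ U : GaugeField (F.P K) 0 (Matrix.specialUnitaryGroup (Fin 2) ℂ),
              descendTo F ℰp n K hnK.le (GaugeField.gaugeAct w U) = descendTo F ℰp n K hnK.le U},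
          ∑ ℓ : PBond (F.P K) 0,
            dist1 (p.2 ℓ * ((GaugeField.gaugeAct (w : Site (F.P K) 0 → Matrix.specialUnitaryGroup (Fin 2) ℂ) (sel p.1)) ℓ)⁻¹) ^ 2)
      ({V | PlaqSmall ε₁ V} ×ˢ univ) := by
  haveI : T2Space (GaugeField (F.P n) 0 (Matrix.specialUnitaryGroup (Fin 2) ℂ)) :=
    inferInstanceAs (T2Space (PBond (F.P n) 0 → Matrix.specialUnitaryGroup (Fin 2) ℂ))
  haveI : RegularSpace (GaugeField (F.P n) 0 (Matrix.specialUnitaryGroup (Fin 2) ℂ)) :=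
    inferInstanceAs (RegularSpace (PBond (F.P n) 0 → Matrix.specialUnitaryGroup (Fin 2) ℂ))
  haveI := compactSpace_residualGauge F hnK.le
  have hε₀ : 0 < ε₀ := (mul_pos hB₃ hε₁).trans hlo
  have hL0 : (0 : ℝ) < (F.L : ℝ) := by exact_mod_cast (show 0 < F.L by have := F.hL.2; omega)
  have hLinv : (0 : ℝ) < (F.L : ℝ)⁻¹ := inv_pos.mpr hL0
  -- letters
  set W : Set (GaugeField (F.P n) 0 (Matrix.specialUnitaryGroup (Fin 2) ℂ)) := {V | PlaqSmall ε₁ V} with hW_def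
  set m : GaugeField (F.P n) 0 (Matrix.specialUnitaryGroup (Fin 2) ℂ) → ℝ := minActionRegPr F n K hnK.le ε₀ with hm_def
  set π : GaugeField (F.P K) 0 (Matrix.specialUnitaryGroup (Fin 2) ℂ) → GaugeField (F.P n) 0 (Matrix.specialUnitaryGroup (Fin 2) ℂ) :=
    descendTo F ℰp n K hnK.le with hπ_def
  set D : GaugeField (F.P K) 0 (Matrix.specialUnitaryGroup (Fin 2) ℂ) × GaugeField (F.P K) 0 (Matrix.specialUnitaryGroup (Fin 2) ℂ) → ℝ :=
    fun q => ⨅ w : {w : Site (F.P K) 0 → Matrix.specialUnitaryGroup (Fin 2) ℂ |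
        ∀ U : GaugeField (F.P K) 0 (Matrix.specialUnitaryGroup (Fin 2) ℂ),
          descendTo F ℰp n K hnK.le (GaugeField.gaugeAct w U) = descendTo F ℰp n K hnK.le U},
      ∑ ℓ : PBond (F.P K) 0,
        dist1 (q.1 ℓ * ((GaugeField.gaugeAct (w : Site (F.P K) 0 → Matrix.specialUnitaryGroup (Fin 2) ℂ) q.2) ℓ)⁻¹) ^ 2 with hD_def
  have hDc : Continuous D := continuous_iInf_orbitDistSq₂ F hnK.le
  set C : Set (GaugeField (F.P K) 0 (Matrix.specialUnitaryGroup (Fin 2) ℂ)) :=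
    {U | ∀ p : Plaq (F.P K) 0, GaugeGroup.dist1 (GaugeField.plaqHol U p) ≤ regThreshold F n K (B₃ * ε₁)} ∩
      {U | ∀ b : PBond (F.P K) 0, ‖covDivT 1 (unitsField (toUField U)) b.dir b.src‖ ≤ (B₃ * ε₁) * ((F.L : ℝ)⁻¹) ^ (3 * (K - n))}
    with hC_def
  have hCcl : IsClosed C := (isClosed_plaqLe F K _).inter (isClosed_divLe F K _)
  have hthr : regThreshold F n K (B₃ * ε₁) < regThreshold F n K ε₀ := by
    show B₃ * ε₁ * ((F.L : ℝ)⁻¹) ^ (2 * (K - n)) < ε₀ * ((F.L : ℝ)⁻¹) ^ (2 * (K - n))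
    exact mul_lt_mul_of_pos_right hlo (pow_pos hLinv _)
  have hdiv : (B₃ * ε₁) * ((F.L : ℝ)⁻¹) ^ (3 * (K - n)) < ε₀ * ((F.L : ℝ)⁻¹) ^ (3 * (K - n)) :=
    mul_lt_mul_of_pos_right hlo (pow_pos hLinv _)
  have hCreg : ∀ U ∈ C, RegPr F n K ε₀ U := fun U hU => ⟨fun p => (hU.1 p).trans_lt hthr, fun b => (hU.2 b).trans_lt hdiv⟩
  have hπC : ContinuousOn π C := fun U hU =>
    (continuousAt_descendTo_of_plaqLe F n K hnK.le hε₀ hr3 hr2 (regThreshold_mono F hlo.le) hU.1).continuousWithinAt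
  have hmW : ContinuousOn m W := continuousOn_minActionRegPr F hT hB₃ hF hnK hε₁ hε₁a hlo hhi hr3 hr2
  -- (8)-regular ⇒ in the closed class `C`
  have hC8 : ∀ {V : GaugeField (F.P n) 0 (Matrix.specialUnitaryGroup (Fin 2) ℂ)} {U : GaugeField (F.P K) 0 (Matrix.specialUnitaryGroup (Fin 2) ℂ)},
      U ∈ regFibrePr F n K hnK.le (B₃ * ε₁) V → U ∈ C ∧ π U = V := by
    intro V U hU
    obtain ⟨hUf, hpl, hdv⟩ := (mem_regFibrePr_iff F).mp hU
    exact ⟨⟨fun p => (hpl p).le, fun b => (hdv b).le⟩, (mem_fibre_iff F ℰp).mp hUf⟩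
  -- every (6)(ε₀)-minimiser over a window datum is a residual translate of `sel V`
  have horb : ∀ {V : GaugeField (F.P n) 0 (Matrix.specialUnitaryGroup (Fin 2) ℂ)}, PlaqSmall ε₁ V →
      ∀ {U : GaugeField (F.P K) 0 (Matrix.specialUnitaryGroup (Fin 2) ℂ)}, U ∈ C → π U = V → wilsonAction4 U = m V →
        ∃ u : {w : Site (F.P K) 0 → Matrix.specialUnitaryGroup (Fin 2) ℂ |
            ∀ U : GaugeField (F.P K) 0 (Matrix.specialUnitaryGroup (Fin 2) ℂ),
              descendTo F ℰp n K hnK.le (GaugeField.gaugeAct w U) = descendTo F ℰp n K hnK.le U},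
          U = GaugeField.gaugeAct (u : Site (F.P K) 0 → Matrix.specialUnitaryGroup (Fin 2) ℂ) (sel V) := by
    intro V hV U hUC hπU hAU
    obtain ⟨hsel8, hselA⟩ := hsel V hV
    have hU6 : U ∈ regFibrePr F n K hnK.le ε₀ V := (mem_regFibrePr_iff F).mpr ⟨(mem_fibre_iff F ℰp).mpr hπU, hCreg U hUC⟩
    have hUmin : IsMinOn (fun W : GaugeField (F.P K) 0 (Matrix.specialUnitaryGroup (Fin 2) ℂ) => wilsonAction4 W)
        (regFibrePr F n K hnK.le ε₀ V) U := fun W hW => by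
      show wilsonAction4 U ≤ wilsonAction4 W
      rw [hAU]
      exact minActionRegPr_le F hW
    have hselmin : (varProblem3 F n K hnK.le).OnMinimalOrbit (B₃ * ε₁) V (sel V) := by
      refine ⟨hsel8, fun W hW => ?_⟩
      show wilsonAction4 (sel V) ≤ wilsonAction4 W
      rw [hselA]
      exact minActionRegPr_le F (regFibrePr_mono F hlo.le V hW)
    obtain ⟨-, huniq⟩ := hU1 F hF n K hnK ε₁ ε₀ hε₁ hε₁a hlo.le hhi V hV (sel V) hselmin
    obtain ⟨u, hu1, hUeq⟩ := huniq U hU6 hUmin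
    exact ⟨⟨u, residual_of_descTransf_eq_one F hnK.le hu1⟩, hUeq⟩
  -- the continuity, at a point `(V₀, U₀)` of the window × fields
  rintro ⟨V₀, U₀⟩ hp
  have hV₀ : PlaqSmall ε₁ V₀ := (mem_prod.mp hp).1
  rw [ContinuousWithinAt, tendsto_def]
  intro O' hO'
  obtain ⟨O'', hO''sub, hO''o, hgO''⟩ := mem_nhds_iff.mp hO'
  -- the tube around `{U₀} × (residual orbit of sel V₀)` inside the `O''`-preimage of the jointly continuous distance
  set Orb : Set (GaugeField (F.P K) 0 (Matrix.specialUnitaryGroup (Fin 2) ℂ)) := range fun w : {w : Site (F.P K) 0 → Matrix.specialUnitaryGroup (Fin 2) ℂ |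
      ∀ U : GaugeField (F.P K) 0 (Matrix.specialUnitaryGroup (Fin 2) ℂ),
        descendTo F ℰp n K hnK.le (GaugeField.gaugeAct w U) = descendTo F ℰp n K hnK.le U} =>
    GaugeField.gaugeAct (w : Site (F.P K) 0 → Matrix.specialUnitaryGroup (Fin 2) ℂ) (sel V₀) with hOrb_def
  have hOrbc : IsCompact Orb := isCompact_range (continuous_gaugeAct_residual F hnK.le (sel V₀))
  have hTo : IsOpen (D ⁻¹' O'') := hO''o.preimage hDc
  have hsubT : ({U₀} : Set (GaugeField (F.P K) 0 (Matrix.specialUnitaryGroup (Fin 2) ℂ))) ×ˢ Orb ⊆ D ⁻¹' O'' := by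
    rintro ⟨U', Ustar⟩ ⟨hU', ⟨w, rfl⟩⟩
    have hU'eq : U' = U₀ := hU'
    subst hU'eq
    show D (U', GaugeField.gaugeAct (w : Site (F.P K) 0 → Matrix.specialUnitaryGroup (Fin 2) ℂ) (sel V₀)) ∈ O''
    have hinv := iInf_orbitDistSq_gaugeAct_residual F hnK.le w.2 U' (sel V₀)
    simp only [hD_def]
    rw [hinv]
    exact hgO''
  obtain ⟨A, B, hAo, hBo, hA, hB, hAB⟩ := generalized_tube_lemma isCompact_singleton hOrbc hTo hsubT
  have hU₀A : U₀ ∈ A := hA (mem_singleton U₀)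
  -- a closed neighbourhood of `V₀` inside the window
  have hWo : IsOpen W := by
    have hset : W = ⋂ p : Plaq (F.P n) 0, {V : GaugeField (F.P n) 0 (Matrix.specialUnitaryGroup (Fin 2) ℂ) |
        GaugeGroup.dist1 (GaugeField.plaqHol V p) < ε₁} := by
      ext V
      simp only [hW_def, mem_setOf_eq, mem_iInter, PlaqSmall]
    rw [hset]
    exact isOpen_iInter_of_finite fun p => isOpen_lt (continuous_dist1_plaqHol (N := 2) p) continuous_const
  obtain ⟨Kc, hKc, hKccl, hKcW⟩ := exists_mem_nhds_isClosed_subset (hWo.mem_nhds hV₀)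
  -- the compact set of (8)-class minimisers over `Kc` lying OFF the open `B`; its descent image is closed and misses `V₀`
  set S : Set (GaugeField (F.P K) 0 (Matrix.specialUnitaryGroup (Fin 2) ℂ)) :=
    ((C ∩ π ⁻¹' Kc) ∩ (fun U => wilsonAction4 U - m (π U)) ⁻¹' {0}) ∩ Bᶜ with hS_def
  have h1 : IsClosed (C ∩ π ⁻¹' Kc) := hπC.preimage_isClosed_of_isClosed hCcl hKccl
  have h2 : ContinuousOn (fun U => wilsonAction4 U - m (π U)) (C ∩ π ⁻¹' Kc) :=
    (continuous_wilsonAction4 (N := 2)).continuousOn.sub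
      (hmW.comp (hπC.mono inter_subset_left) fun U hU => hKcW hU.2)
  have hScl : IsClosed S := (h2.preimage_isClosed_of_isClosed h1 isClosed_singleton).inter hBo.isClosed_compl
  have hSc : IsCompact S := isCompact_of_isClosed_cfg hScl
  have hπS : IsClosed (π '' S) :=
    (hSc.image_of_continuousOn (hπC.mono fun U hU => hU.1.1.1)).isClosed
  have hV₀S : V₀ ∉ π '' S := by
    rintro ⟨U, ⟨⟨⟨hUC, -⟩, hUA⟩, hUB⟩, hπU⟩
    have hA0 : wilsonAction4 U = m V₀ := by
      have h0 : wilsonAction4 U - m (π U) = 0 := hUA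
      rw [hπU] at h0
      linarith
    obtain ⟨u, hUeq⟩ := horb hV₀ hUC hπU hA0
    exact hUB (hB ⟨u, hUeq.symm⟩)
  -- the neighbourhood of `(V₀, U₀)` on which the distance stays in `O′`
  have hN : (Kc ∩ (π '' S)ᶜ) ×ˢ A ∈ 𝓝 (V₀, U₀) :=
    prod_mem_nhds (inter_mem hKc (hπS.isOpen_compl.mem_nhds hV₀S)) (hAo.mem_nhds hU₀A)
  filter_upwards [mem_nhdsWithin_of_mem_nhds hN, self_mem_nhdsWithin] with q hq hqW
  obtain ⟨⟨hVK, hVS⟩, hUA⟩ := hq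
  have hVW : PlaqSmall ε₁ q.1 := (mem_prod.mp hqW).1
  obtain ⟨hselC, hπsel⟩ := hC8 (hsel q.1 hVW).1
  have hselB : sel q.1 ∈ B := by
    by_contra hnot
    refine hVS ⟨sel q.1, ⟨⟨⟨hselC, ?_⟩, ?_⟩, hnot⟩, hπsel⟩
    · show π (sel q.1) ∈ Kc
      rw [hπsel]; exact hVK
    · show wilsonAction4 (sel q.1) - m (π (sel q.1)) = 0
      rw [hπsel, (hsel q.1 hVW).2]
      exact sub_self _
  have hmem : (q.2, sel q.1) ∈ D ⁻¹' O'' := hAB (mk_mem_prod hUA hselB)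
  rw [Set.mem_preimage] at hmem ⊢
  exact hO''sub hmem

end MinimalOrbit

/-! ## §4 Every `L ≥ 5`: the letter with the selection supplied, zero hypotheses -/

section Five

open Summit.QuantumFields.YangMills.Theorems.FluctuationComparisonRegPrIntLS2BetaSymmetriesLiftOfCritical (thm1Pair_five)
open Summit.QuantumFields.YangMills.Theorems.FluctuationComparisonRegPrIntLS2BetaMinActionRegPrContinuousOn (admissible_of_le)

/-- ★★ **THE MINIMAL ORBIT IS CONTINUOUS IN THE DATUM — EVERY `L ≥ 5`, ZERO LETTERS** (✓`thm1Pair_five` = [Balaban1985Variational] Thm 1, both sentences, as tree theorems):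
constants `a₁, B₃, e > 0` such that for every member with block size `L`, every `n < K`, radii `0 < ε₁ ≤ a₁`, `B₃ε₁ < ε₀ ≤ e`, THERE IS a selection `sel` of
(8)-regular minimisers over the window `{PlaqSmall ε₁}` whose residual-orbit distance `(V, U) ↦ ⨅_w Σ_ℓ dist1 (U ℓ · (w • sel V)ℓ⁻¹)²` is `ContinuousOn (window ×ˢ univ)`.
[cite: Balaban1985Variational, Thm 1 (8) p.279, Prop. 7 p.299 and Prop. 9 p.309] -/
theorem continuousOn_iInf_orbitDistSq_minimiser_five (F : T3Family) (h5 : 5 ≤ F.L) :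
    ∃ a₁ B₃ e : ℝ, 0 < a₁ ∧ 0 < B₃ ∧ 0 < e ∧ ∀ {n K : ℕ} (hnK : n < K) (ε₁ ε₀ : ℝ), 0 < ε₁ → ε₁ ≤ a₁ → B₃ * ε₁ < ε₀ → ε₀ ≤ e →
      ∃ sel : GaugeField (F.P n) 0 (Matrix.specialUnitaryGroup (Fin 2) ℂ) → GaugeField (F.P K) 0 (Matrix.specialUnitaryGroup (Fin 2) ℂ),
        (∀ V : GaugeField (F.P n) 0 (Matrix.specialUnitaryGroup (Fin 2) ℂ), PlaqSmall ε₁ V →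
          sel V ∈ regFibrePr F n K hnK.le (B₃ * ε₁) V ∧ wilsonAction4 (sel V) = minActionRegPr F n K hnK.le ε₀ V) ∧
        ContinuousOn (fun p : GaugeField (F.P n) 0 (Matrix.specialUnitaryGroup (Fin 2) ℂ) × GaugeField (F.P K) 0 (Matrix.specialUnitaryGroup (Fin 2) ℂ) =>
            ⨅ w : {w : Site (F.P K) 0 → Matrix.specialUnitaryGroup (Fin 2) ℂ |
                ∀ U : GaugeField (F.P K) 0 (Matrix.specialUnitaryGroup (Fin 2) ℂ),
                  descendTo F ℰp n K hnK.le (GaugeField.gaugeAct w U) = descendTo F ℰp n K hnK.le U},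
              ∑ ℓ : PBond (F.P K) 0,
                dist1 (p.2 ℓ * ((GaugeField.gaugeAct (w : Site (F.P K) 0 → Matrix.specialUnitaryGroup (Fin 2) ℂ) (sel p.1)) ℓ)⁻¹) ^ 2)
          ({V | PlaqSmall ε₁ V} ×ˢ univ) := by
  obtain ⟨a₀, a₁, B₃, ha₀, ha₁, hB₃, hT, hU1⟩ := thm1Pair_five F.L h5
  have hL : 1 ≤ F.L := by omega
  set eL : ℝ := min (1 / (6 * (143 * ((((3 + 4 : ℕ) : ℝ)) ^ 2 / 4) ^ 2))) (deltaSU (Fin 2) / (2 * (((3 + 4) * F.L : ℕ) : ℝ) ^ 2))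
    with heL
  have h7 : (0 : ℝ) < (((3 + 4) * F.L : ℕ) : ℝ) ^ 2 := by
    have : 0 < (3 + 4) * F.L := by omega
    positivity
  have heL0 : 0 < eL := lt_min (by positivity) (div_pos deltaSU_pos (by positivity))
  refine ⟨a₁, B₃, min a₀ eL, ha₁, hB₃, lt_min ha₀ heL0, fun hnK ε₁ ε₀ hε₁ hε₁a hlo hε₀e => ?_⟩
  obtain ⟨hr3, hr2⟩ := admissible_of_le F.L hL (hε₀e.trans (min_le_right _ _))
  have hhi : ε₀ ≤ a₀ := hε₀e.trans (min_le_left _ _)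
  -- the selection: Thm 1 (8) at every window datum
  classical
  have hex : ∀ V : GaugeField (F.P _) 0 (Matrix.specialUnitaryGroup (Fin 2) ℂ), PlaqSmall ε₁ V →
      ∃ U ∈ regFibrePr F _ _ hnK.le (B₃ * ε₁) V, wilsonAction4 U = minActionRegPr F _ _ hnK.le ε₀ V := by
    intro V hV
    obtain ⟨U, hU8, hmin⟩ := hT F rfl _ _ hnK ε₁ ε₀ hε₁ hε₁a hlo.le hhi V hV
    exact ⟨U, hU8, minActionRegPr_eq_of_isMinOn F (regFibrePr_mono F hlo.le V hU8) hmin⟩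
  set sel : GaugeField (F.P _) 0 (Matrix.specialUnitaryGroup (Fin 2) ℂ) → GaugeField (F.P _) 0 (Matrix.specialUnitaryGroup (Fin 2) ℂ) :=
    fun V => if hV : PlaqSmall ε₁ V then Classical.choose (hex V hV) else 1 with hsel_def
  have hsel : ∀ V : GaugeField (F.P _) 0 (Matrix.specialUnitaryGroup (Fin 2) ℂ), PlaqSmall ε₁ V →
      sel V ∈ regFibrePr F _ _ hnK.le (B₃ * ε₁) V ∧ wilsonAction4 (sel V) = minActionRegPr F _ _ hnK.le ε₀ V := by
    intro V hV
    have hsV : sel V = Classical.choose (hex V hV) := by rw [hsel_def]; exact dif_pos hV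
    rw [hsV]
    obtain ⟨h8, hA⟩ := Classical.choose_spec (hex V hV)
    exact ⟨h8, hA⟩
  exact ⟨sel, hsel, continuousOn_iInf_orbitDistSq_minimiser F hT hU1 hB₃ rfl hnK hε₁ hε₁a hlo hhi hr3 hr2 sel hsel⟩

end Five

end Summit.QuantumFields.YangMills.Theorems.FluctuationComparisonRegPrIntLS2BetaMinimalOrbitContinuousOn

end
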